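import Summits.SmoothPoincare4.SmoothPoincare4.Theses.CongruenceShadows

/-!
# Sketch (crux-ideate, round 1, ideator 3 / gen 2) — first lemmas for two crux idea cards on
`CongruenceShadows.ShadowApproximation` (item stmt-SmoothPoincare4-14595)

* card `level-rigidity` : `LevelRigid`, `LevelRigidity`, `shadowApproximation_of_levelRigidity`
  (PROVED: one level of the shadow hypothesis + level rigidity ⟹ the crux, verbatim);
  `reglue`, `PureRegluingRigid`, `pureRegluing_of_levelRigid` (PROVED: the pure-congruence regluing
  statement is the core special case of level rigidity).
* card `cyclotomic-unit-absorption` : `UnitAbsorption`, `OrbitClosed`,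
  `normalised_of_unitAbsorption`, `shadowApproximation_of_unitAbsorption` (PROVED: UA ∧ OrbitClosed
  ⟹ the crux, verbatim; slot normalisation by `hW 0 1`).

Transport lemmas §0 are copied (with attribution) from the lead's skeleton
`Cruxes/ShadowApproximation/Lines/free-shadow-tsystem.lean` §0 so that this file is self-contained.
-/

noncomputable section

namespace Summit.SmoothPoincare4.SmoothPoincare4.Cruxes.ShadowApproximation.Sketch3g2

set_option linter.dupNamespace false

open Literature.Topology.FourManifolds
open Summit.SmoothPoincare4.SmoothPoincare4.Theses.CongruenceShadows

/-! ## §0 Notation and transport (after Lines/free-shadow-tsystem.lean §0) -/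

/-- `S_g` at the crux's genus `g = 3 + 3m`. -/
abbrev S (m : ℕ) : Type := SurfaceGroup (3 + 3 * m)

/-- The standard kernel triple of genus `3 + 3m`. -/
abbrev N (m : ℕ) : TrisectionKernels (3 + 3 * m) := s4Kernels.stabilizeIter m

/-- Standard shadows in every characteristic finite quotient (the crux's `hS`). -/
def Shadows (m : ℕ) (K : TrisectionKernels (3 + 3 * m)) : Prop :=
  ∀ M : Subgroup (S m), M.Characteristic → M.FiniteIndex →
    ∃ ψ : S m ≃* S m, ∀ i : Fin 3, (N m i ⊔ M).map ψ.toMonoidHom = K i ⊔ M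

/-- Waldhausen normalisation (the crux's `hW`). -/
def Pairs (m : ℕ) (K : TrisectionKernels (3 + 3 * m)) : Prop :=
  ∀ i j : Fin 3, i ≠ j → ∃ α : S m ≃* S m,
    (N m i).map α.toMonoidHom = K i ∧ (N m j).map α.toMonoidHom = K j

/-- READ-BACK of the crux. -/
theorem crux_iff :
    ShadowApproximation ↔ ∀ (m : ℕ) (K : TrisectionKernels (3 + 3 * m)),
      IsGroupTrisection (3 + 3 * m) (m + 1) (PUnit : Type) K → Pairs m K → Shadows m K →
        TrisectionKernels.Iso (N m) K :=
  Iff.rfl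

section transport
variable {G : Type*} [Group G]

theorem map_trans (e₁ e₂ : G ≃* G) (H : Subgroup G) :
    H.map (e₁.trans e₂).toMonoidHom = (H.map e₁.toMonoidHom).map e₂.toMonoidHom := by
  rw [Subgroup.map_map]; rfl

theorem map_map_symm (e : G ≃* G) (H : Subgroup G) :
    (H.map e.toMonoidHom).map e.symm.toMonoidHom = H := by
  ext x; simp

theorem map_symm_map (e : G ≃* G) (H : Subgroup G) :
    (H.map e.symm.toMonoidHom).map e.toMonoidHom = H := by
  ext x; simp

theorem map_symm_of_map (e : G ≃* G) {H K : Subgroup G} (h : H.map e.toMonoidHom = K) :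
    K.map e.symm.toMonoidHom = H := by
  rw [← h, map_map_symm]

/-- Characteristic subgroups are fixed by automorphisms (as `Subgroup.map`). -/
theorem map_char (e : G ≃* G) (M : Subgroup G) (hM : M.Characteristic) :
    M.map e.toMonoidHom = M :=
  (Subgroup.characteristic_iff_map_eq.mp hM) e

end transport

variable {g : ℕ}

/-- `Aut S_g`-invariance of the group-trisection property (Lines/free-shadow-tsystem.lean). -/
theorem isGroupTrisection_map {k : ℕ} {G : Type*} [Group G] {K : TrisectionKernels g}
    (hK : IsGroupTrisection g k G K) (α : SurfaceGroup g ≃* SurfaceGroup g) :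
    IsGroupTrisection g k G (fun i => (K i).map α.toMonoidHom) := by
  have hsurj : Function.Surjective (α : SurfaceGroup g →* SurfaceGroup g) := α.surjective
  have himg : ∀ i, ((K i).map α.toMonoidHom : Set (SurfaceGroup g)) = α '' (K i) := fun i =>
    Subgroup.coe_map _ _
  have hnc : ∀ s : Set (SurfaceGroup g),
      (Subgroup.normalClosure s).map (α : SurfaceGroup g →* SurfaceGroup g) =
        Subgroup.normalClosure (α '' s) := fun s =>
    Subgroup.map_normalClosure s _ hsurj
  refine ⟨fun i => (hK.normal i).map α.toMonoidHom α.surjective, fun i => ?_, fun i j hij => ?_, ?_⟩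
  · refine (hK.free_quotient i).of_mulEquiv (QuotientGroup.congr _ _ α ?_)
    simp only [hnc, himg]
  · refine (hK.free_pairQuotient i j hij).of_mulEquiv (QuotientGroup.congr _ _ α ?_)
    simp only [hnc, himg, Set.image_union]
  · obtain ⟨e⟩ := hK.triple
    refine ⟨(QuotientGroup.congr _ _ α ?_).symm.trans e⟩
    simp only [hnc, himg, Set.image_iUnion]

variable {m : ℕ}

/-- Transport of `hS` along `γ ∈ Aut S`. -/
theorem shadows_transport (γ : S m ≃* S m) {K : TrisectionKernels (3 + 3 * m)}
    (hS : Shadows m K) : Shadows m (fun i => (K i).map γ.toMonoidHom) := by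
  intro M hM hMf
  obtain ⟨ψ, hψ⟩ := hS M hM hMf
  refine ⟨ψ.trans γ, fun i => ?_⟩
  show (N m i ⊔ M).map (ψ.trans γ).toMonoidHom = (K i).map γ.toMonoidHom ⊔ M
  rw [map_trans, hψ i, Subgroup.map_sup, map_char γ M hM]

/-- Transport of the conclusion: `N ≅ γ⁻¹ • K` implies `N ≅ K`. -/
theorem iso_transport (γ : S m ≃* S m) {K : TrisectionKernels (3 + 3 * m)}
    (h : TrisectionKernels.Iso (N m) (fun i => (K i).map γ.symm.toMonoidHom)) :
    TrisectionKernels.Iso (N m) K := by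
  obtain ⟨β, hβ⟩ := h
  refine ⟨β.trans γ, fun i => ?_⟩
  rw [map_trans, hβ i]
  exact map_symm_map γ (K i)

/-- Shadows at a finer level give shadows at a coarser level with the SAME `ψ`. -/
theorem shadow_mono {M M' : Subgroup (S m)} (hle : M' ≤ M) (hM : M.Characteristic)
    (ψ : S m ≃* S m) {A B : Subgroup (S m)}
    (h : (A ⊔ M').map ψ.toMonoidHom = B ⊔ M') :
    (A ⊔ M).map ψ.toMonoidHom = B ⊔ M := by
  have hA : A ⊔ M = (A ⊔ M') ⊔ M := by
    rw [sup_assoc, sup_eq_right.mpr hle]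
  have hB : B ⊔ M = (B ⊔ M') ⊔ M := by
    rw [sup_assoc, sup_eq_right.mpr hle]
  rw [hA, Subgroup.map_sup, h, map_char ψ M hM, ← hB]

/-! ## §1 Card `level-rigidity` — finite determinacy of the standard trisection

`LevelRigid m M₀`: every `(3+3m, m+1)` group trisection of `{1}` that agrees with the standard
triple `N` MODULO ONE characteristic finite-index level `M₀` (literally `Nᵢ M₀ = Kᵢ M₀`, no
automorphism) is isomorphic to `N`. `LevelRigidity`: such a level exists at every genus. ONE
application of the shadow hypothesis (at `M₀`) then proves the crux. -/

/-- Level rigidity of the standard trisection at the level `M₀`. -/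
def LevelRigid (m : ℕ) (M₀ : Subgroup (S m)) : Prop :=
  ∀ K : TrisectionKernels (3 + 3 * m),
    IsGroupTrisection (3 + 3 * m) (m + 1) (PUnit : Type) K →
      (∀ i : Fin 3, N m i ⊔ M₀ = K i ⊔ M₀) → TrisectionKernels.Iso (N m) K

/-- C⁺ of card `level-rigidity`: at every genus some characteristic finite-index level decides. -/
def LevelRigidity : Prop :=
  ∀ m : ℕ, ∃ M₀ : Subgroup (S m), M₀.Characteristic ∧ M₀.FiniteIndex ∧ LevelRigid m M₀

/-- **First lemma (PROVED).** Level rigidity implies the crux, using the shadow hypothesis at the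
single level `M₀` and never using `hW`. -/
theorem shadowApproximation_of_levelRigidity (h : LevelRigidity) : ShadowApproximation := by
  intro m K hK _hW hS
  obtain ⟨M₀, hc, hf, hR⟩ := h m
  obtain ⟨ψ, hψ⟩ := hS M₀ hc hf
  -- pull `K` back along `ψ`: `K' = ψ⁻¹ • K` agrees with `N` modulo `M₀`
  have hK' := isGroupTrisection_map hK ψ.symm
  have hlev : ∀ i : Fin 3, N m i ⊔ M₀ = (K i).map ψ.symm.toMonoidHom ⊔ M₀ := by
    intro i
    have this : ((N m i ⊔ M₀).map ψ.toMonoidHom).map ψ.symm.toMonoidHom =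
        (K i ⊔ M₀).map ψ.symm.toMonoidHom := congrArg _ (hψ i)
    rw [map_map_symm] at this
    rw [this, Subgroup.map_sup, map_char ψ.symm M₀ hc]
  exact iso_transport ψ (hR _ hK' hlev)

/-- Congruence to the identity modulo `M` moves no subgroup modulo `M`. -/
theorem sup_eq_map_sup {G : Type*} [Group G] (κ : G ≃* G) (H M : Subgroup G)
    (hκ : ∀ s, κ s * s⁻¹ ∈ M) : H ⊔ M = H.map κ.toMonoidHom ⊔ M := by
  apply le_antisymm
  · refine sup_le ?_ le_sup_right
    intro x hx
    have h1 : κ x ∈ H.map κ.toMonoidHom := ⟨x, hx, rfl⟩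
    have h2 : (κ x * x⁻¹)⁻¹ ∈ M := M.inv_mem (hκ x)
    have hx' : x = (κ x * x⁻¹)⁻¹ * κ x := by group
    rw [hx']
    exact Subgroup.mul_mem _ (Subgroup.mem_sup_right h2) (Subgroup.mem_sup_left h1)
  · refine sup_le ?_ le_sup_right
    rintro _ ⟨x, hx, rfl⟩
    have hx' : κ.toMonoidHom x = (κ x * x⁻¹) * x := by simp
    rw [hx']
    exact Subgroup.mul_mem _ (Subgroup.mem_sup_right (hκ x)) (Subgroup.mem_sup_left hx)

/-- Regluing the third handlebody of the standard triple by `κ ∈ Aut S`: `(N₀, N₁, κ N₂)`. -/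
def reglue (m : ℕ) (κ : S m ≃* S m) : TrisectionKernels (3 + 3 * m) :=
  fun i => if i = 2 then (N m 2).map κ.toMonoidHom else N m i

@[simp] theorem reglue_zero (κ : S m ≃* S m) : reglue m κ 0 = N m 0 := by
  simp [reglue]

@[simp] theorem reglue_one (κ : S m ≃* S m) : reglue m κ 1 = N m 1 := by
  simp [reglue]

@[simp] theorem reglue_two (κ : S m ≃* S m) : reglue m κ 2 = (N m 2).map κ.toMonoidHom := by
  simp [reglue]

/-- **The pure core of level rigidity** (the case the card's engine attacks): a regluing of the
third standard handlebody by an automorphism `κ` of the handlebody group `A = Stab N₀` lying in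
the level-`M₀` CONGRUENCE KERNEL (`κ ≡ id mod M₀`; pure in Ivanov's sense once `M₀ ≤ S^{(3)}`)
that still yields a trisection of `{1}` is undone by a symmetry of the standard pair `(N₀,N₁)`. -/
def PureRegluingRigid (m : ℕ) (M₀ : Subgroup (S m)) : Prop :=
  ∀ κ : S m ≃* S m, (∀ s, κ s * s⁻¹ ∈ M₀) → (N m 0).map κ.toMonoidHom = N m 0 →
    IsGroupTrisection (3 + 3 * m) (m + 1) (PUnit : Type) (reglue m κ) →
      ∃ γ : S m ≃* S m, (N m 0).map γ.toMonoidHom = N m 0 ∧ (N m 1).map γ.toMonoidHom = N m 1 ∧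
        (N m 2).map γ.toMonoidHom = (N m 2).map κ.toMonoidHom

/-- Level rigidity at `M₀` contains the pure regluing statement at `M₀` (PROVED). -/
theorem pureRegluing_of_levelRigid {M₀ : Subgroup (S m)} (h : LevelRigid m M₀) :
    PureRegluingRigid m M₀ := by
  intro κ hκ _h0 hT
  have hlev : ∀ i : Fin 3, N m i ⊔ M₀ = reglue m κ i ⊔ M₀ := by
    intro i
    fin_cases i
    · simp
    · simp
    · simpa using sup_eq_map_sup κ (N m 2) M₀ hκ
  obtain ⟨α, hα⟩ := h _ hT hlev
  exact ⟨α, by simpa using hα 0, by simpa using hα 1, by simpa using hα 2⟩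

/-! ## §2 Card `cyclotomic-unit-absorption` — the level-stabiliser excess of the standard pair is
absorbed by the stabiliser of the standard triple

`UnitAbsorption m` (finite shadow of the profinite statement
`Stab_{cl Aut S}(N̂₀,N̂₁) = cl(A∩B) · Stab_{cl Aut S}(N̂₀,N̂₁,N̂₂)`): for every level `M` there is a
deeper level `M'` such that whatever an automorphism stabilising `N₀M'` and `N₁M'` does to `N₂`
modulo `M` is already done by an HONEST element of the Heegaard group `A ∩ B = Stab(N₀) ∩ Stab(N₁)`.
`OrbitClosed m`: on the gate locus the `(A∩B)`-orbit of `N₂` is closed in the congruence topology.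
-/

/-- Finite-level unit absorption for the standard pair relative to the standard triple. -/
def UnitAbsorption (m : ℕ) : Prop :=
  ∀ M : Subgroup (S m), M.Characteristic → M.FiniteIndex →
    ∃ M' : Subgroup (S m), M'.Characteristic ∧ M'.FiniteIndex ∧ M' ≤ M ∧
      ∀ ψ : S m ≃* S m,
        (N m 0 ⊔ M').map ψ.toMonoidHom = N m 0 ⊔ M' →
        (N m 1 ⊔ M').map ψ.toMonoidHom = N m 1 ⊔ M' →
          ∃ γ : S m ≃* S m, (N m 0).map γ.toMonoidHom = N m 0 ∧
            (N m 1).map γ.toMonoidHom = N m 1 ∧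
            (N m 2 ⊔ M).map γ.toMonoidHom = (N m 2 ⊔ M).map ψ.toMonoidHom

/-- Orbit closure on the gate locus: a third kernel completing `(N₀,N₁)` to a trisection of `{1}`
and congruent at every level to an `(A∩B)`-translate of `N₂` IS an `(A∩B)`-translate of `N₂`. -/
def OrbitClosed (m : ℕ) : Prop :=
  ∀ K : TrisectionKernels (3 + 3 * m),
    IsGroupTrisection (3 + 3 * m) (m + 1) (PUnit : Type) K → K 0 = N m 0 → K 1 = N m 1 →
      (∀ M : Subgroup (S m), M.Characteristic → M.FiniteIndex →
        ∃ γ : S m ≃* S m, (N m 0).map γ.toMonoidHom = N m 0 ∧ (N m 1).map γ.toMonoidHom = N m 1 ∧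
          (N m 2 ⊔ M).map γ.toMonoidHom = K 2 ⊔ M) →
      ∃ γ : S m ≃* S m, (N m 0).map γ.toMonoidHom = N m 0 ∧ (N m 1).map γ.toMonoidHom = N m 1 ∧
        (N m 2).map γ.toMonoidHom = K 2

/-- **First lemma, normalised form (PROVED).** For a slot-normalised trisection of `{1}` with
standard shadows, unit absorption + orbit closure give `Iso N K`. -/
theorem normalised_of_unitAbsorption (hU : UnitAbsorption m) (hO : OrbitClosed m)
    (K : TrisectionKernels (3 + 3 * m))
    (hK : IsGroupTrisection (3 + 3 * m) (m + 1) (PUnit : Type) K)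
    (h0 : K 0 = N m 0) (h1 : K 1 = N m 1) (hS : Shadows m K) :
    TrisectionKernels.Iso (N m) K := by
  have key : ∀ M : Subgroup (S m), M.Characteristic → M.FiniteIndex →
      ∃ γ : S m ≃* S m, (N m 0).map γ.toMonoidHom = N m 0 ∧ (N m 1).map γ.toMonoidHom = N m 1 ∧
        (N m 2 ⊔ M).map γ.toMonoidHom = K 2 ⊔ M := by
    intro M hc hf
    obtain ⟨M', hc', hf', hle, hUA⟩ := hU M hc hf
    obtain ⟨ψ, hψ⟩ := hS M' hc' hf'
    have e0 : (N m 0 ⊔ M').map ψ.toMonoidHom = N m 0 ⊔ M' := by rw [hψ 0, h0]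
    have e1 : (N m 1 ⊔ M').map ψ.toMonoidHom = N m 1 ⊔ M' := by rw [hψ 1, h1]
    obtain ⟨γ, hγ0, hγ1, hγ2⟩ := hUA ψ e0 e1
    refine ⟨γ, hγ0, hγ1, ?_⟩
    rw [hγ2]
    exact shadow_mono hle hc ψ (hψ 2)
  obtain ⟨γ, hγ0, hγ1, hγ2⟩ := hO K hK h0 h1 key
  refine ⟨γ, fun i => ?_⟩
  fin_cases i
  · simpa [h0] using hγ0
  · simpa [h1] using hγ1
  · simpa using hγ2

/-- **Composition (PROVED).** `(∀ m, UnitAbsorption m) → (∀ m, OrbitClosed m) → ShadowApproximation`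
(slot normalisation by `hW 0 1`, transport of every hypothesis along `α⁻¹`). -/
theorem shadowApproximation_of_unitAbsorption
    (hU : ∀ m, UnitAbsorption m) (hO : ∀ m, OrbitClosed m) : ShadowApproximation := by
  intro m K hK hW hS
  obtain ⟨α, hα0, hα1⟩ := hW 0 1 (by decide)
  let K' : TrisectionKernels (3 + 3 * m) := fun i => (K i).map α.symm.toMonoidHom
  have hK' : IsGroupTrisection (3 + 3 * m) (m + 1) (PUnit : Type) K' :=
    isGroupTrisection_map hK α.symm
  have h0 : K' 0 = N m 0 := map_symm_of_map α hα0
  have h1 : K' 1 = N m 1 := map_symm_of_map α hα1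
  have hS' : Shadows m K' := shadows_transport α.symm hS
  exact iso_transport α (normalised_of_unitAbsorption (hU m) (hO m) K' hK' h0 h1 hS')

/-- Sanity: `OrbitClosed` alone already gives the crux for kernels congruent LEVELWISE to honest
`(A∩B)`-translates; `UnitAbsorption` is exactly what upgrades the crux's level stabilisers
`Stab(N₀M, N₁M) ∋ ψ_M` (which exceed `(A∩B)·K(M)` by units, route NUMBERS) to such translates. -/
theorem unitAbsorption_std_witness (M : Subgroup (S m)) :
    ∃ γ : S m ≃* S m, (N m 0).map γ.toMonoidHom = N m 0 ∧ (N m 1).map γ.toMonoidHom = N m 1 ∧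
      (N m 2 ⊔ M).map γ.toMonoidHom = (N m 2 ⊔ M).map (MulEquiv.refl (S m)).toMonoidHom :=
  ⟨MulEquiv.refl _, by simp, by simp, rfl⟩

end Summit.SmoothPoincare4.SmoothPoincare4.Cruxes.ShadowApproximation.Sketch3g2

end
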